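import Summits.NavierStokesRegularity.NavierStokesRegularity.Theorems.TypeICertificateLadderRungReynoldsOne
import HarnessLib

/-!
# Route TypeICertificateLadder — the explicit Leray-rate constant `1` at a singular time (C31-F)

Named corollaries of the landed rung `X_1` (`typeICertificateLadder_rungReynoldsOne`, crux item
stmt-NavierStokesRegularity-2882, closed · proved): its contrapositive says that a classical
solution of the unforced Navier–Stokes system on `ℝ³ × [0, T)` (`ν, T > 0`), Leray–Hopf on `[0, T]`
from its rapidly decaying datum, which does NOT extend smoothly past `T`, has collapse Reynolds
number exceeding one arbitrarily close to `T`: for `t < T` arbitrarily close to `T` there is a point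
`x` with `√(T − t) ‖u(t, x)‖ > √ν`. Equivalently `limsup_{t ↑ T} √((T − t)/ν) ‖u(t)‖_∞ ≥ 1` — Leray's
first character of an irregularity (Leray 1934, §19 (3.9), `V(t) > A √(ν/(T − t))` with an
unspecified constant `A`) with the EXPLICIT constant `1` for the Fefferman / Leray–Hopf class. This
module only unpacks the negation through the `∀ᶠ`/`∃ᶠ` filter vocabulary; all analysis is in the
imported rung file. Four phrasings: the `∃ᶠ` form under the rung's hypotheses, the same for a
maximal smooth solution (`IsMaximalSmoothSolution`, the hypothetical object of `X5a`), the
filter-free `∀ t₀ < T, ∃ t ∈ (t₀, T), ∃ x, …` form, and the `limsup ≥ 1` form with the spatial sup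
norm valued in `ℝ≥0∞` (so that no boundedness side condition is needed).

HONEST FRAMING: statements about a HYPOTHETICAL singular time; nothing here asserts that such a
time exists, and nothing here bears on the regularity question itself.
-/

noncomputable section

open Filter Topology Set

namespace Summit.NavierStokesRegularity.NavierStokesRegularity.Theorems

set_option linter.dupNamespace false

/-- **Leray rate with constant one, Fefferman / Leray–Hopf class (C31-F), `∃ᶠ` form.** A classical
solution of the unforced Navier–Stokes system on `ℝ³ × [0, T)` (`ν, T > 0`), Leray–Hopf on `[0, T]`
from its rapidly decaying datum, with no smooth extension past `T`, satisfies
`√ν < √(T − t) ‖u(t, x)‖` for some `x`, frequently as `t ↑ T`. Contrapositive of the landed rung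
`typeICertificateLadder_rungReynoldsOne` (stmt-NavierStokesRegularity-2882). -/
theorem typeICertificateLadder_lerayRate_frequently_gt
    (ν T : ℝ) (hν : 0 < ν) (hT : 0 < T)
    (u : ℝ → EuclideanSpace ℝ (Fin 3) → EuclideanSpace ℝ (Fin 3))
    (p : ℝ → EuclideanSpace ℝ (Fin 3) → ℝ)
    (hsol : Literature.Analysis.FluidPDE.IsClassicalNSSolutionOn (Set.Ico 0 T) ν 0 u p)
    (hLH : Literature.Analysis.FluidPDE.IsLerayHopfOn T ν 0 (u 0) u)
    (hdec : Literature.Analysis.FluidPDE.HasRapidSpatialDecay (u 0))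
    (hsing : ¬ Literature.Analysis.FluidPDE.HasSmoothExtensionPast ν 0 u T) :
    ∃ᶠ t in 𝓝[<] T, ∃ x, Real.sqrt ν < Real.sqrt (T - t) * ‖u t x‖ := by
  by_contra h
  simp only [Filter.not_frequently, not_exists, not_lt] at h
  exact hsing (typeICertificateLadder_rungReynoldsOne ν T hν hT u p hsol hLH hdec h)

/-- **C31-F for a maximal smooth solution.** For a maximal smooth solution with lifespan `T > 0`
(`IsMaximalSmoothSolution`: classical on `[0, T)`, no smooth extension past `T`) of the unforced
system, Leray–Hopf on `[0, T]` from its rapidly decaying datum — the hypothetical object of the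
blow-up conjunct `X5a` — one has `√ν < √(T − t) ‖u(t, x)‖` for some `x`, frequently as `t ↑ T`. -/
theorem lerayRate_frequently_gt_of_isMaximalSmoothSolution
    (ν T : ℝ) (hν : 0 < ν) (hT : 0 < T)
    (u : ℝ → EuclideanSpace ℝ (Fin 3) → EuclideanSpace ℝ (Fin 3))
    (p : ℝ → EuclideanSpace ℝ (Fin 3) → ℝ)
    (hmax : Literature.Analysis.FluidPDE.IsMaximalSmoothSolution ν 0 u p T)
    (hLH : Literature.Analysis.FluidPDE.IsLerayHopfOn T ν 0 (u 0) u)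
    (hdec : Literature.Analysis.FluidPDE.HasRapidSpatialDecay (u 0)) :
    ∃ᶠ t in 𝓝[<] T, ∃ x, Real.sqrt ν < Real.sqrt (T - t) * ‖u t x‖ :=
  typeICertificateLadder_lerayRate_frequently_gt ν T hν hT u p hmax.1 hLH hdec hmax.2

/-- **C31-F, filter-free form.** Under the hypotheses of
`lerayRate_frequently_gt_of_isMaximalSmoothSolution`: for every `t₀ < T` there are a time
`t ∈ (t₀, T)` and a point `x` with `√ν < √(T − t) ‖u(t, x)‖`. -/
theorem lerayRate_exists_gt_of_isMaximalSmoothSolution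
    (ν T : ℝ) (hν : 0 < ν) (hT : 0 < T)
    (u : ℝ → EuclideanSpace ℝ (Fin 3) → EuclideanSpace ℝ (Fin 3))
    (p : ℝ → EuclideanSpace ℝ (Fin 3) → ℝ)
    (hmax : Literature.Analysis.FluidPDE.IsMaximalSmoothSolution ν 0 u p T)
    (hLH : Literature.Analysis.FluidPDE.IsLerayHopfOn T ν 0 (u 0) u)
    (hdec : Literature.Analysis.FluidPDE.HasRapidSpatialDecay (u 0)) :
    ∀ t₀ < T, ∃ t, t₀ < t ∧ t < T ∧ ∃ x, Real.sqrt ν < Real.sqrt (T - t) * ‖u t x‖ := by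
  intro t₀ ht₀
  have hfr := lerayRate_frequently_gt_of_isMaximalSmoothSolution ν T hν hT u p hmax hLH hdec
  have hmem : Set.Ioo t₀ T ∈ 𝓝[<] T := Ioo_mem_nhdsLT ht₀
  obtain ⟨t, ⟨x, hx⟩, ht⟩ := (hfr.and_eventually hmem).exists
  exact ⟨t, ht.1, ht.2, x, hx⟩

/-- **C31-F, `limsup` form: `limsup_{t ↑ T} √((T − t)/ν) ‖u(t)‖_∞ ≥ 1`.** Under the hypotheses of
`lerayRate_frequently_gt_of_isMaximalSmoothSolution`, the upper limit as `t ↑ T` of the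
`ℝ≥0∞`-valued spatial supremum `⨆ x, √((T − t)/ν) ‖u(t, x)‖` is at least `1` (the supremum is
taken in `ℝ≥0∞`, so no boundedness of the slices is presupposed). -/
theorem one_le_limsup_lerayRate_of_isMaximalSmoothSolution
    (ν T : ℝ) (hν : 0 < ν) (hT : 0 < T)
    (u : ℝ → EuclideanSpace ℝ (Fin 3) → EuclideanSpace ℝ (Fin 3))
    (p : ℝ → EuclideanSpace ℝ (Fin 3) → ℝ)
    (hmax : Literature.Analysis.FluidPDE.IsMaximalSmoothSolution ν 0 u p T)
    (hLH : Literature.Analysis.FluidPDE.IsLerayHopfOn T ν 0 (u 0) u)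
    (hdec : Literature.Analysis.FluidPDE.HasRapidSpatialDecay (u 0)) :
    1 ≤ Filter.limsup (fun t => ⨆ x, ENNReal.ofReal (Real.sqrt ((T - t) / ν) * ‖u t x‖))
      (𝓝[<] T) := by
  have hfr := lerayRate_frequently_gt_of_isMaximalSmoothSolution ν T hν hT u p hmax hLH hdec
  refine Filter.le_limsup_of_frequently_le (hfr.mono ?_)
  rintro t ⟨x, hx⟩
  refine le_iSup_of_le x ?_
  rw [← ENNReal.ofReal_one]
  apply ENNReal.ofReal_le_ofReal
  have hsν : 0 < Real.sqrt ν := Real.sqrt_pos.2 hν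
  rw [Real.sqrt_div' _ hν.le, div_mul_eq_mul_div, le_div_iff₀ hsν, one_mul]
  exact hx.le

end Summit.NavierStokesRegularity.NavierStokesRegularity.Theorems

end
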